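import Mathlib.Data.Sym.Card
import Mathlib.Data.Fintype.Vector
import Summits.ValiantsHypothesis.ValiantsHypothesis.Theorems.KPlusLogSqLawTropicalBSplitDefs
import Summits.ValiantsHypothesis.ValiantsHypothesis.Theorems.KPlusLogSqLawTropicalBTwoRowSharpUnsigned
import Summits.ValiantsHypothesis.ValiantsHypothesis.Theorems.KPlusLogSqLawTropicalCensusThreeFour
import Summits.ValiantsHypothesis.ValiantsHypothesis.Theorems.KPlusLogSqLawTropicalCensusFourFourTight

/-!
# Route «KPlusLogSqLaw», crux `TropicalB` (stmt-ValiantsHypothesis-19771) — COUNTING-TIGHTNESS DESCENDS IN `K`: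
# the formats `(m, K)` carrying a chain through ALL `C(m+K−1, m)` class multisets form, for each `m`, an initial segment `K ≤ κ(m)`

HONEST FRAMING.  Helper toward the registered stubs `stub_tropThin` / `stub_tropFat` of `Cruxes/TropicalB/Lines/birth.lean` (crux
`Summit.ValiantsHypothesis.ValiantsHypothesis.Theses.KPlusLogSqLaw.TropicalB`, item stmt-ValiantsHypothesis-19771, route KPlusLogSqLaw,
DRAFT; cell `pub-symmetroid`, seat val-sym-trop-p4 g12, 2026-08-28; `--supports … --as helper`).  A STRUCTURE law of the tropical
census (valid at every format, no hypothesis on exponents, valuations or support) plus its calibration on kernel cells; it bounds nothing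
for `TropicalB` in its window and bears on neither `WeakLifting`, DoorA26 / DoorA34, `MatrixDescartes` (stmt-ValiantsHypothesis-18050)
nor VP ≠ VNP.  The companion file `…TropicalBTightnessThresholdLog` derives from `TropicalB` that `κ(m) = O(log m)`.

VOCABULARY (tree: `TropRowD` / `DesignRowD` of `…TropicalBSplitDefs`, `TropRootLawAt`, `Nat.multichoose K m = C(m+K−1, m)` = the
number of class multisets of a format-`(m, K)` term = the slope-counting ceiling `tropRowD_slopeCount`).  Call the format `(m, K)`
COUNTING-TIGHT if some design has an (unsigned) dominant chain with `multichoose K m` terms, i.e. `¬ TropRowD m K (multichoose K m − 2)`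
(stated inline; no definition is introduced).  Kernel cells of record: `(m,2)`, `(m,3)` tight for all `m` (`T(m,2) = m`,
`tropRootLawAt_three_iff`), `(2,4) = 9`, `(3,4) = 19`, `(4,4) = 34` tight, `(2,K)` not tight for `K ≥ 5` (`T_D(2,K) = 4K − 7`);
located: `(3,5) ≤ 33 < 34` (val-sym-trop-p4 g5), `(5,4) ≥ 49` of `55`, `(6,4) ≥ 65` of `83` (val-sym-trop-p5 g9).

THE LAW.
* `isDominant_delete` — deleting a class: a term avoiding class `0`, read in the design with class `0` deleted (classes re-indexed along
  `Fin.succ`), keeps weight, sign and DOMINANCE (its competitors there are among its competitors before).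
* `exists_tight_chain_delete` — **EXTRACTION**: in a counting-tight chain of format `(m, K+2)` every class multiset occurs exactly once
  (slope counting is attained), so the terms avoiding class `0` are exactly `multichoose (K+1) m` many (`Sym.e2`); in chain order they
  descend to a counting-tight chain of the class-deleted design of format `(m, K+1)` (slopes still increase, consecutive terms differ).
* `not_tropRowD_tight_pred`, `not_tropRowD_tight_of_le` — **counting-tightness at `(m, K')` implies counting-tightness at every `(m, K)`,
  `2 ≤ K ≤ K'`** (relabel so that the deleted class is `0`; at `K = 1` the statement is false — one multiset, no breakpoint);
  `tropRowD_notTight_mono` — contrapositive: **non-tightness propagates UP in `K`**; `not_tropRowD_tight_of_signed` — a sign-alternating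
  tight cell feeds the unsigned threshold.  So for each size `m` the tight formats are `{K : 2 ≤ K ≤ κ(m)}` for a threshold
  `κ(m) ∈ {3, 4, …} ∪ {∞}` (`κ(m) ≥ 3` by SHIFT-THREE-PLUS).
* Calibration (§4): `two_row_tight_iff` (`κ(2) = 4`: for `K ≥ 3`, `(2,K)` is tight iff `K ≤ 4`), `three_row_tight_of_le_four`,
  `four_row_tight_of_le_four` (`κ(3), κ(4) ≥ 4` by descent from the kernel cells `(3,4) = 19`, `(4,4) = 34`).

READING (located, not claimed).  (i) ONE decided cell now closes the rest of its size-`m` row of the tightness census: a proof of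
`T_D(5,4) ≤ 53` would give `κ(5) = 3` and settle every `(5, K)`, `K ≥ 4`, as non-tight; a tight `(5,5)` certificate would give
`T(5,4) = 55` without search.  (ii) Descent applies to EVERY subset of classes (iterate after relabelling): a counting-tight design of
format `(m, K)` restricts to counting-tight designs on each of its `C(K, j)` sub-alphabets — a rigidity that grows with `K` (at `(2,5)`
all five 4-class restrictions of one design would have to be tight `(2,4)` designs, and none is).  (iii) By the companion file,
`TropicalB` forces `κ(m) < C₀·log₂ m` for large `m`; the census question this law makes cheap to track is the growth of `κ(m)`
(`κ(2) = 4`, `κ(3) = 4` located, `κ(4) ≥ 4`; first undecided cells `(5,4)`, `(4,5)`, `(5,5)`).  [this file; the deletion /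
extraction argument is folklore-level bookkeeping on the cell's slope counting]
-/

set_option linter.dupNamespace false
set_option autoImplicit false

namespace Summit.ValiantsHypothesis.ValiantsHypothesis.Theorems.KPlusLogSqLaw

open Summit.ValiantsHypothesis.ValiantsHypothesis.Theorems.MatrixDescartes.Negative
open Summit.ValiantsHypothesis.ValiantsHypothesis.Theorems.LacunarySymmetroidMatrixDescartes
open Summit.ValiantsHypothesis.ValiantsHypothesis.Theorems.LacunarySymmetroidMatrixDescartes.TropicalCensus
open scoped BigOperators
open Finset

namespace Tightness

variable {m K : ℕ}

/-! ### 1. Deleting the class `0`: terms avoiding it keep their weight, sign and dominance -/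

/-- The weight of a term of the design with class `0` deleted is the weight of its lift. -/
theorem tropWeight_delete (d : Fin (K + 1) → ℕ) (v : Fin m → Fin m → Fin (K + 1) → ℤ) (θ : ℤ)
    (q : Equiv.Perm (Fin m) × (Fin m → Fin K)) :
    tropWeight (fun l => d l.succ) (fun a b l => v a b l.succ) θ q = tropWeight d v θ (q.1, Fin.succ ∘ q.2) := rfl

/-- The sign of a term of the design with class `0` deleted is the sign of its lift. -/
theorem termSign_delete (ε : Fin m → Fin m → Fin (K + 1) → ℤ) (q : Equiv.Perm (Fin m) × (Fin m → Fin K)) :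
    termSign (fun a b l => ε a b l.succ) q = termSign ε (q.1, Fin.succ ∘ q.2) := rfl

/-- Lifting terms along `Fin.succ` is injective. -/
theorem lift_injective (q q' : Equiv.Perm (Fin m) × (Fin m → Fin K))
    (h : ((q.1, Fin.succ ∘ q.2) : Equiv.Perm (Fin m) × (Fin m → Fin (K + 1))) = (q'.1, Fin.succ ∘ q'.2)) : q = q' := by
  obtain ⟨h1, h2⟩ := Prod.mk.inj h
  refine Prod.ext h1 (funext fun i => Fin.succ_injective _ (congrFun h2 i))

/-- **Class deletion preserves dominance.**  If the lift `(σ, Fin.succ ∘ μ)` of a term is the unique optimum of the design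
`(d, v, ε)` at slope `θ`, then `(σ, μ)` is the unique optimum at `θ` of the design with class `0` deleted (its competitors are
the lifts' competitors). [folklore] -/
theorem isDominant_delete (d : Fin (K + 1) → ℕ) (v ε : Fin m → Fin m → Fin (K + 1) → ℤ) (θ : ℤ)
    (q : Equiv.Perm (Fin m) × (Fin m → Fin K)) (h : IsDominant d v ε θ (q.1, Fin.succ ∘ q.2)) :
    IsDominant (fun l => d l.succ) (fun a b l => v a b l.succ) (fun a b l => ε a b l.succ) θ q := by
  refine ⟨?_, fun q' hne hpres => ?_⟩
  · rw [termSign_delete]; exact h.1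
  · have hne' : ((q'.1, Fin.succ ∘ q'.2) : Equiv.Perm (Fin m) × (Fin m → Fin (K + 1))) ≠ (q.1, Fin.succ ∘ q.2) :=
      fun heq => hne (lift_injective q' q heq)
    have hp' : termSign ε (q'.1, Fin.succ ∘ q'.2) ≠ 0 := by rw [← termSign_delete]; exact hpres
    have hlt := h.2 _ hne' hp'
    rw [tropWeight_delete, tropWeight_delete]
    exact hlt

/-- A term avoids the class `0` iff `0` is not in its class multiset. -/
theorem zero_not_mem_classSym_iff (p : Equiv.Perm (Fin m) × (Fin m → Fin (K + 1))) :
    (0 : Fin (K + 1)) ∉ classSym p ↔ ∀ i, p.2 i ≠ 0 := by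
  unfold classSym
  rw [Sym.mem_mk, Multiset.mem_map]
  simp only [Finset.mem_val, Finset.mem_univ, true_and, not_exists]

/-- The descent of a term avoiding class `0` to the design with class `0` deleted. -/
theorem lift_descend (p : Equiv.Perm (Fin m) × (Fin m → Fin (K + 1))) (hp : ∀ i, p.2 i ≠ 0) :
    ((p.1, Fin.succ ∘ fun i => (p.2 i).pred (hp i)) : Equiv.Perm (Fin m) × (Fin m → Fin (K + 1))) = p := by
  refine Prod.ext rfl (funext fun i => ?_)
  simp only [Function.comp_apply, Fin.succ_pred]


/-! ### 2. A counting-tight chain restricts to a counting-tight chain of the class-deleted design -/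

/-- **Extraction.**  Let `p₀, …, pₙ` be unique optima of a design of format `(m, K+2)` at strictly increasing integer slopes,
with distinct consecutive terms, and suppose the chain is COUNTING-TIGHT: `multichoose (K+2) m ≤ n + 1` (so, by slope counting, every
class multiset of size `m` over `Fin (K+2)` is the multiset of exactly one term of the chain).  Then the terms avoiding class `0`, in
their order along the chain, descend to a chain of unique optima of the design with class `0` deleted (format `(m, K+1)`), at strictly
increasing slopes, with distinct consecutive terms, and with at least `multichoose (K+1) m` terms — i.e. a counting-tight chain again. -/
theorem exists_tight_chain_delete {n : ℕ} (d : Fin (K + 2) → ℕ) (v ε : Fin m → Fin m → Fin (K + 2) → ℤ)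
    (θ : Fin (n + 1) → ℤ) (p : Fin (n + 1) → Equiv.Perm (Fin m) × (Fin m → Fin (K + 2)))
    (hθ : StrictMono θ) (hdom : ∀ k, IsDominant d v ε (θ k) (p k)) (hne : ∀ k : Fin n, p k.castSucc ≠ p k.succ)
    (htight : Nat.multichoose (K + 2) m ≤ n + 1) :
    ∃ (n' : ℕ) (θ' : Fin (n' + 1) → ℤ) (p' : Fin (n' + 1) → Equiv.Perm (Fin m) × (Fin m → Fin (K + 1))),
      StrictMono θ' ∧
      (∀ k, IsDominant (fun l => d l.succ) (fun a b l => v a b l.succ) (fun a b l => ε a b l.succ) (θ' k) (p' k)) ∧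
      (∀ k : Fin n', p' k.castSucc ≠ p' k.succ) ∧
      Nat.multichoose (K + 1) m ≤ n' + 1 := by
  classical
  -- the class-multiset map along the chain is injective, hence (by tightness) bijective
  have hsm := slope_strictMono_of_chainD d v ε θ p hθ hdom hne
  set F : Fin (n + 1) → Sym (Fin (K + 2)) m := fun k => classSym (p k) with hF
  have hinj : Function.Injective F := by
    intro k k' h
    apply hsm.injective
    simp only
    rw [slope_eq_of_classSym, slope_eq_of_classSym]
    exact congrArg (fun M : Sym (Fin (K + 2)) m => ((M : Multiset (Fin (K + 2))).map fun l => (d l : ℤ)).sum) h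
  have hcardSym : Fintype.card (Sym (Fin (K + 2)) m) = Nat.multichoose (K + 2) m :=
    Sym.card_sym_fin_eq_multichoose (K + 2) m
  have hbij : Function.Bijective F := by
    rw [Fintype.bijective_iff_injective_and_card]
    refine ⟨hinj, le_antisymm ?_ ?_⟩
    · exact Fintype.card_le_of_injective F hinj
    · rw [hcardSym, Fintype.card_fin]; exact htight
  -- the chain positions avoiding class `0`
  set S : Finset (Fin (n + 1)) := univ.filter fun k => (0 : Fin (K + 2)) ∉ F k with hS
  have hmemS : ∀ {k}, k ∈ S ↔ ∀ i, (p k).2 i ≠ 0 := by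
    intro k
    rw [hS, Finset.mem_filter]
    simp only [Finset.mem_univ, true_and]
    exact zero_not_mem_classSym_iff (p k)
  -- its cardinality is the number of class multisets avoiding `0`, i.e. `multichoose (K+1) m`
  have hTcard : (univ.filter fun s : Sym (Fin (K + 2)) m => (0 : Fin (K + 2)) ∉ s).card = Nat.multichoose (K + 1) m := by
    rw [← Fintype.card_subtype, ← Sym.card_sym_fin_eq_multichoose (K + 1) m]
    exact Fintype.card_congr Sym.e2
  have hScard : S.card = Nat.multichoose (K + 1) m := by
    rw [← hTcard, ← Finset.card_image_of_injective S hinj]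
    congr 1
    ext s
    simp only [Finset.mem_image, Finset.mem_filter, Finset.mem_univ, true_and, hS]
    constructor
    · rintro ⟨k, hk, rfl⟩; exact hk
    · intro hs
      obtain ⟨k, hk⟩ := hbij.2 s
      exact ⟨k, hk ▸ hs, hk⟩
  -- `S` is nonempty: `multichoose (K+1) m ≥ 1`
  have hSpos : 1 ≤ S.card := by
    rw [hScard]
    have : Nat.multichoose 1 m ≤ Nat.multichoose (K + 1) m := by
      rw [Nat.multichoose_eq, Nat.multichoose_eq]
      simpa using Nat.choose_le_choose m (by omega : 1 + m - 1 ≤ K + 1 + m - 1)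
    simpa [Nat.multichoose_one] using this
  obtain ⟨n', hn'⟩ : ∃ n', S.card = n' + 1 := ⟨S.card - 1, by omega⟩
  -- enumerate `S` increasingly
  let g : Fin (n' + 1) ↪o Fin (n + 1) := S.orderEmbOfFin hn'
  have hgS : ∀ k, g k ∈ S := fun k => S.orderEmbOfFin_mem hn' k
  have hg0 : ∀ k i, (p (g k)).2 i ≠ 0 := fun k => hmemS.mp (hgS k)
  refine ⟨n', fun k => θ (g k), fun k => ((p (g k)).1, fun i => ((p (g k)).2 i).pred (hg0 k i)), ?_, ?_, ?_, ?_⟩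
  · exact hθ.comp g.strictMono
  · intro k
    apply isDominant_delete
    rw [lift_descend (p (g k)) (hg0 k)]
    exact hdom (g k)
  · intro k heq
    have hlt : g k.castSucc < g k.succ := g.strictMono Fin.castSucc_lt_succ
    have hpeq : p (g k.castSucc) = p (g k.succ) := by
      rw [← lift_descend (p (g k.castSucc)) (hg0 k.castSucc), ← lift_descend (p (g k.succ)) (hg0 k.succ)]
      obtain ⟨h1, h2⟩ := Prod.mk.inj heq
      refine Prod.ext h1 ?_
      change Fin.succ ∘ (fun i => ((p (g k.castSucc)).2 i).pred (hg0 k.castSucc i)) =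
        Fin.succ ∘ (fun i => ((p (g k.succ)).2 i).pred (hg0 k.succ i))
      rw [h2]
    exact absurd (congrArg (fun q => slope d q) hpeq) (ne_of_lt (hsm hlt))
  · rw [← hScard, hn']

/-! ### 3. Counting-tightness is an initial segment in `K` -/

/-- **COUNTING-TIGHTNESS DESCENDS IN `K`.**  If some design of format `(m, K+1)` has an unsigned dominant chain through ALL
`multichoose (K+1) m` class multisets (the unsigned row `TropRowD m (K+1) ·` fails at `multichoose (K+1) m − 2`), then some design
of format `(m, K)` has one through all `multichoose K m` class multisets (`2 ≤ K`; for `K = 1` the statement is false, for `m = 0`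
it is vacuous).  Equivalently: the set of `K` at which the size-`m` row is counting-tight is an initial segment `{2, …, κ(m)}` (or all
`K ≥ 2`). [this file] -/
theorem not_tropRowD_tight_pred (hK : 2 ≤ K) (h : ¬ TropRowD m (K + 1) (Nat.multichoose (K + 1) m - 2)) :
    ¬ TropRowD m K (Nat.multichoose K m - 2) := by
  obtain ⟨K', rfl⟩ : ∃ K', K = K' + 2 := ⟨K - 2, by omega⟩
  rcases Nat.eq_zero_or_pos m with rfl | hm
  · -- `m = 0`: one term, no breakpoint; the hypothesis fails
    exfalso; apply h
    have h0 := tropRowD_slopeCount 0 (K' + 2 + 1)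
    simp only [Nat.multichoose_zero_right] at h0 ⊢
    exact h0
  intro hrow
  apply h
  intro d v ε n θ p hθ hdom hne
  by_contra hlt
  push Not at hlt
  have htight : Nat.multichoose (K' + 1 + 2) m ≤ n + 1 := by
    have : Nat.multichoose (K' + 2 + 1) m = Nat.multichoose (K' + 1 + 2) m := by ring_nf
    omega
  obtain ⟨n', θ', p', hθ', hdom', hne', htight'⟩ :=
    exists_tight_chain_delete (K := K' + 1) d v ε θ p hθ hdom hne htight
  have hle := hrow _ _ _ n' θ' p' hθ' hdom' hne'
  have hg : Nat.multichoose (K' + 1 + 1) m = Nat.multichoose (K' + 2) m := rfl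
  rw [hg] at htight'
  -- `multichoose (K'+2) m ≥ m + 1 ≥ 2`, so `n' ≤ N − 2` contradicts `N ≤ n' + 1`
  have hN : m + 1 ≤ Nat.multichoose (K' + 2) m := by
    have h2 : Nat.multichoose 2 m ≤ Nat.multichoose (K' + 2) m := by
      rw [Nat.multichoose_eq, Nat.multichoose_eq]
      exact Nat.choose_le_choose m (by omega)
    rw [Nat.multichoose_two] at h2
    exact h2
  omega

/-- Iterated form: counting-tightness at `(m, K')` descends to every `K` with `2 ≤ K ≤ K'`. -/
theorem not_tropRowD_tight_of_le {K' : ℕ} (hK : 2 ≤ K) (hKK' : K ≤ K')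
    (h : ¬ TropRowD m K' (Nat.multichoose K' m - 2)) : ¬ TropRowD m K (Nat.multichoose K m - 2) := by
  obtain ⟨j, rfl⟩ : ∃ j, K' = K + j := ⟨K' - K, by omega⟩
  induction j with
  | zero => simpa using h
  | succ j ih =>
    apply ih (by omega)
    exact not_tropRowD_tight_pred (by omega) (by simpa [Nat.add_assoc] using h)

/-- **Non-tightness propagates UP in `K`** (contrapositive): if NO design of format `(m, K)` is counting-tight (`2 ≤ K`), then no design
of any format `(m, K')`, `K' ≥ K`, is.  One decided cell closes the whole rest of its size-`m` row of the tightness census. -/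
theorem tropRowD_notTight_mono {K' : ℕ} (hK : 2 ≤ K) (hKK' : K ≤ K')
    (h : TropRowD m K (Nat.multichoose K m - 2)) : TropRowD m K' (Nat.multichoose K' m - 2) := by
  by_contra h'
  exact not_tropRowD_tight_of_le hK hKK' h' h

/-- Signed census data feed the unsigned threshold: a SIGN-ALTERNATING counting-tight chain at `(m, K')` (the row `TropRootLawAt m K' ·`
fails at `multichoose K' m − 2`, as for the kernel cells `(3,4) = 19`, `(4,4) = 34`) gives unsigned counting-tight chains at every
`(m, K)`, `2 ≤ K ≤ K'`. -/
theorem not_tropRowD_tight_of_signed {K' : ℕ} (hK : 2 ≤ K) (hKK' : K ≤ K')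
    (h : ¬ TropRootLawAt m K' (Nat.multichoose K' m - 2)) : ¬ TropRowD m K (Nat.multichoose K m - 2) :=
  not_tropRowD_tight_of_le hK hKK' fun h' => h (tropRootLawAt_of_tropRowD h')

/-! ### 4. Kernel calibration: `κ(2) = 4`, `κ(3) ≥ 4`, `κ(4) ≥ 4` -/

/-- **The size-2 row: counting-tight exactly for `K ≤ 4`** (`K ≥ 3`; `K = 2` is tight too but the tree's two-row lemmas start at
`K = 3`): `T_D(2,K) = 4K − 7` (`tropRowD_two_sharp` / `not_tropRowD_two_sharp`, val-sym-trop-p3) equals `multichoose K 2 − 1 =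
C(K+1,2) − 1` iff `K ∈ {3, 4}`, and non-tightness at `K = 5` propagates to every `K ≥ 5` by `tropRowD_notTight_mono`. -/
theorem two_row_tight_iff (hK : 3 ≤ K) : ¬ TropRowD 2 K (Nat.multichoose K 2 - 2) ↔ K ≤ 4 := by
  constructor
  · intro h
    by_contra h5
    push Not at h5
    apply h
    have h13 : TropRowD 2 5 (Nat.multichoose 5 2 - 2) := by
      have e : Nat.multichoose 5 2 - 2 = 4 * 5 - 7 := by rw [Nat.multichoose_eq]; decide
      rw [e]; exact tropRowD_two_sharp 5 (by norm_num)
    exact tropRowD_notTight_mono (by norm_num) h5 h13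
  · intro h4
    interval_cases K
    · have e : Nat.multichoose 3 2 - 2 = 4 * 3 - 8 := by rw [Nat.multichoose_eq]; decide
      rw [e]; exact not_tropRowD_two_sharp 3 (by norm_num)
    · have e : Nat.multichoose 4 2 - 2 = 4 * 4 - 8 := by rw [Nat.multichoose_eq]; decide
      rw [e]; exact not_tropRowD_two_sharp 4 (by norm_num)

/-- The size-3 row is counting-tight at every `2 ≤ K ≤ 4`: descent from the kernel cell `T(3,4) = 19 = C(6,3) − 1`
(`census_three_four_exact`, val-sym-lift-p1). -/
theorem three_row_tight_of_le_four (hK2 : 2 ≤ K) (hK4 : K ≤ 4) : ¬ TropRowD 3 K (Nat.multichoose K 3 - 2) :=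
  not_tropRowD_tight_of_signed hK2 hK4 (by
    have e : Nat.multichoose 4 3 - 2 = 18 := by rw [Nat.multichoose_eq]; decide
    rw [e]; exact census_three_four_exact.2)

/-- The size-4 row is counting-tight at every `2 ≤ K ≤ 4`: descent from the kernel cell `T(4,4) = 34 = C(7,3) − 1`
(`census_four_four_exact`, val-sym-lift-p1). -/
theorem four_row_tight_of_le_four (hK2 : 2 ≤ K) (hK4 : K ≤ 4) : ¬ TropRowD 4 K (Nat.multichoose K 4 - 2) :=
  not_tropRowD_tight_of_signed hK2 hK4 (by
    have e : Nat.multichoose 4 4 - 2 = 33 := by rw [Nat.multichoose_eq]; decide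
    rw [e]; exact census_four_four_exact.2)

end Tightness

end Summit.ValiantsHypothesis.ValiantsHypothesis.Theorems.KPlusLogSqLaw
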